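import Mathlib
import HarnessLib
import Literature.MathematicalPhysics.QuantumLattice.GrassmannGaussConvKernelBound
import Summits.HubbardSuperconductivity.HubbardSuperconductivity.Theorems.KLProgrammeKLRegimeWickCrossIterate

/-!
# Route `KLProgramme` — crux K3, ENGINE child (stmt-HubbardSuperconductivity-19918), stub `stub_engine_step_values`, (E2-v9):
# the `k`-FOLD CROSS CONTRACTION in closed form (all `k`) — the generator of the `k`-line two-vertex graphs of the Wick step
# (cell gate-hubbard-kl, seat p5 g4; E2-WICK-ROADMAP §5 (iv), HOME/prover-p5/E5-GAIN-SCALE-N.md (S1))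

Sequel to p483614 (`…WickStarProduct`: the single cross contraction `Δ_×(C)(a⁰·b¹)`), p485455 (`…WickCrossIterate`: `Δ_×(C)²`) and
p487051 (`…WickMixedContraction`: `Δ_×(C₁)Δ_×(C₂)`).  The second-order Wick term of the scale-`n` step is
`−½·dblFold((e^{Δ_×(g)} − 1)(e^{Δ_×(D)}(𝒲⁰·𝒲¹)))`; its part with `k` lines between the two copies is a sum of `k`-fold cross
contractions `Δ_×(C_{k−1}) ∘ ⋯ ∘ Δ_×(C_0)` with each `C_i ∈ {g, D}` (at least one `g`).  The classes `k ≥ 3` (triple and higher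
contractions — the overlapping graphs whose values the non-ladder budget `eremBar`'s `CR(Klam|U|)³2^{−n}` term must absorb) need the
formula for GENERAL `k`:

* `grassmannDeriv_involute_iterate` — `∂_X (ι^[k] a) = (−1)^k • ι^[k] (∂_X a)` (`ι` the parity involution);
* **`crossLaplacian_listProd_copy_mul_copy`** — for covariances `C : Fin k → Matrix Γ Γ R` and ALL `a, b`,
  `(Δ_×(C_{k−1}) ∘ ⋯ ∘ Δ_×(C_0)) (dblCopy 0 a · dblCopy 1 b)
     = (−1)^{k(k−1)/2} • Σ_{X Y : Fin k → Γ} (∏_i contr C_i (X i) (Y i)) • (dblCopy 0 (ι^[k] (∂_X a)) · dblCopy 1 (∂_Y b))`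
  (`∂_X = iterDeriv X`, `contr C X Y = ½(C Y X − C X Y)`): `k` lines, the `i`-th carrying the two-point function of `C_i`, one end
  on a leg of `a`, the other on a leg of `b`; no line returns to its own vertex;
* `crossLaplacian_pow_copy_mul_copy` — the case of equal covariances, `Δ_×(C)^k (a⁰·b¹)`.

Generic (commutative `ℚ`-algebra `R`, finite labels); exact algebra, no definitions, nothing about the model is asserted.  The kernels of the
folded result and their sectorised `L¹–L^∞` bounds with sector LEVELS (FKTo3 Prop. XII) follow in the sequel files.

References: J. Feldman, H. Knörrer, E. Trubowitz, *Fermionic Functional Integrals and the Renormalization Group* (AMS 2002), §I.4 (Wick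
ordering, products of Wick monomials); Rev. Math. Phys. 15 (2003) 1121–1169 (*Single scale analysis … 3: sectorized norms*), Prop. XII
(«three contractions»); cell files HOME/p1/E2-WICK-ROADMAP.md §1/§5, HOME/prover-p5/E5-GAIN-SCALE-N.md.
-/

noncomputable section

namespace Summit.HubbardSuperconductivity.HubbardSuperconductivity.Theorems.KLRegimeWick

set_option linter.dupNamespace false -- summit = problem name (single-conjunct summit), D-0017

open Literature.MathematicalPhysics.QuantumLattice GrassmannAlgebra Finset Matrix

section Generic

variable (R : Type*) [CommRing R] [Algebra ℚ R] {Γ : Type*} [Fintype Γ] [DecidableEq Γ]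

/-! ## §1 Derivatives through iterated involutions -/

omit [Fintype Γ] [DecidableEq Γ] [Algebra ℚ R] in
/-- `∂_X (ι^[k] a) = (−1)^k • ι^[k] (∂_X a)`: each parity involution passed costs a sign. [folklore] -/
theorem grassmannDeriv_involute_iterate {Γ' : Type*} (X : Γ') (k : ℕ) (a : GrassmannAlgebra R Γ') :
    grassmannDeriv R X (CliffordAlgebra.involute^[k] a) = (-1 : R) ^ k • CliffordAlgebra.involute^[k] (grassmannDeriv R X a) := by
  induction k generalizing a with
  | zero => simp
  | succ k ih =>
    rw [Function.iterate_succ_apply', Function.iterate_succ_apply', grassmannDeriv_involute, ih, map_smul, pow_succ,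
      mul_neg_one, neg_smul]

omit [Fintype Γ] [DecidableEq Γ] [Algebra ℚ R] in
/-- The iterated involution is `R`-linear (it is an algebra map). [folklore] -/
theorem involute_iterate_smul {Γ' : Type*} (k : ℕ) (r : R) (a : GrassmannAlgebra R Γ') :
    CliffordAlgebra.involute^[k] (r • a) = r • CliffordAlgebra.involute^[k] a := by
  induction k generalizing a with
  | zero => simp
  | succ k ih => rw [Function.iterate_succ_apply', Function.iterate_succ_apply', ih, map_smul]

/-! ## §2 The `k`-fold cross contraction -/

omit [Fintype Γ] [DecidableEq Γ] in
/-- The product `∏_{i : Fin (k+1)}` of a `snoc`-indexed family splits off its last factor. [folklore] -/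
theorem prod_contr_snoc {k : ℕ} (C : Fin (k + 1) → Matrix Γ Γ R) (X Y : Fin k → Γ) (x y : Γ) :
    (∏ i : Fin (k + 1), contr R (C i) ((Fin.snoc X x : Fin (k + 1) → Γ) i) ((Fin.snoc Y y : Fin (k + 1) → Γ) i)) =
      (∏ i : Fin k, contr R (C (Fin.castSucc i)) (X i) (Y i)) * contr R (C (Fin.last k)) x y := by
  rw [Fin.prod_univ_castSucc]
  simp only [Fin.snoc_castSucc, Fin.snoc_last]

omit [Algebra ℚ R] in
/-- The sign bookkeeping `(−1)^{k(k−1)/2} · (−1)^k = (−1)^{(k+1)k/2}`. [folklore] -/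
theorem neg_one_pow_triangle_succ (k : ℕ) : (-1 : R) ^ (k * (k - 1) / 2) * (-1) ^ k = (-1) ^ ((k + 1) * k / 2) := by
  rw [← pow_add]
  congr 1
  rcases Nat.even_or_odd k with ⟨j, hj⟩ | ⟨j, hj⟩
  · subst hj
    rcases j with _ | j
    · simp
    · have h1 : (j + 1 + (j + 1)) * (j + 1 + (j + 1) - 1) / 2 = (j + 1) * (2 * j + 1) := by
        rw [show j + 1 + (j + 1) - 1 = 2 * j + 1 by omega, show (j + 1 + (j + 1)) * (2 * j + 1) = (j + 1) * (2 * j + 1) * 2 by ring,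
          Nat.mul_div_cancel _ two_pos]
      have h2 : (j + 1 + (j + 1) + 1) * (j + 1 + (j + 1)) / 2 = (2 * j + 3) * (j + 1) := by
        rw [show (j + 1 + (j + 1) + 1) * (j + 1 + (j + 1)) = (2 * j + 3) * (j + 1) * 2 by ring, Nat.mul_div_cancel _ two_pos]
      rw [h1, h2]; ring
  · subst hj
    have h1 : (2 * j + 1) * (2 * j + 1 - 1) / 2 = (2 * j + 1) * j := by
      rw [show 2 * j + 1 - 1 = 2 * j by omega, show (2 * j + 1) * (2 * j) = (2 * j + 1) * j * 2 by ring, Nat.mul_div_cancel _ two_pos]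
    have h2 : (2 * j + 1 + 1) * (2 * j + 1) / 2 = (j + 1) * (2 * j + 1) := by
      rw [show (2 * j + 1 + 1) * (2 * j + 1) = (j + 1) * (2 * j + 1) * 2 by ring, Nat.mul_div_cancel _ two_pos]
    rw [h1, h2]; ring

/-- **The `k`-fold cross contraction in closed form**: for covariances `C₀, …, C_{k−1}` and ALL `a, b`,
`(Δ_×(C_{k−1}) ∘ ⋯ ∘ Δ_×(C_0)) (dblCopy 0 a · dblCopy 1 b) = (−1)^{k(k−1)/2} • Σ_{X,Y : Fin k → Γ} (∏_i contr C_i (X i) (Y i)) •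
(dblCopy 0 (ι^[k] (∂_X a)) · dblCopy 1 (∂_Y b))` — `k` lines between the two copies, the `i`-th with the two-point function of `C_i`,
no self-line (the operator product is written as the reversed `List.ofFn` product, `Δ_×(C_0)` acting first, as in `iterDeriv`).
[cite: FeldmanKnorrerTrubowitz2002, §I.4 (Wick ordering and products of Wick monomials)] -/
theorem crossLaplacian_listProd_copy_mul_copy :
    ∀ (k : ℕ) (C : Fin k → Matrix Γ Γ R) (a b : GrassmannAlgebra R Γ),
      ((List.ofFn fun i => grassmannLaplacian R (crossCov R (C i))).reverse).prod (dblCopy R 0 a * dblCopy R 1 b) =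
        (-1 : R) ^ (k * (k - 1) / 2) • ∑ X : Fin k → Γ, ∑ Y : Fin k → Γ, (∏ i, contr R (C i) (X i) (Y i)) •
          (dblCopy R 0 (CliffordAlgebra.involute^[k] (iterDeriv R X a)) * dblCopy R 1 (iterDeriv R Y b))
  | 0, C, a, b => by
    have h1 : ∀ (X : Fin 0 → Γ) (c : GrassmannAlgebra R Γ), iterDeriv R X c = c := fun X c => by simp [iterDeriv]
    rw [List.ofFn_zero, List.reverse_nil, List.prod_nil, Module.End.one_apply]
    simp only [Nat.zero_mul, Nat.zero_div, pow_zero, one_smul, Finset.univ_unique, Finset.sum_singleton,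
      Finset.univ_eq_empty, Finset.prod_empty, Function.iterate_zero, id_eq, h1]
  | k + 1, C, a, b => by
    -- peel the last Laplacian: `Δ_×(C_k) ∘ (Δ_×(C_{k−1}) ∘ ⋯ ∘ Δ_×(C_0))`
    have ih := crossLaplacian_listProd_copy_mul_copy k (fun i => C (Fin.castSucc i)) a b
    rw [List.ofFn_succ', List.concat_eq_append, List.reverse_append, List.reverse_singleton, List.singleton_append,
      List.prod_cons, Module.End.mul_apply, ih, map_smul]
    simp only [map_sum, map_smul, grassmannLaplacian_crossCov_copy_mul_copy]
    -- the new line: `ι ∂_x (ι^[k] ∂_X a) = (−1)^k ι^[k+1] ∂_{snoc X x} a`, `∂_y ∂_Y b = ∂_{snoc Y y} b`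
    set S : (Fin k → Γ) → (Fin k → Γ) → Γ → Γ → GrassmannAlgebra R (Γ × Fin 2) := fun X Y x y =>
      dblCopy R 0 (CliffordAlgebra.involute^[k + 1] (iterDeriv R (Fin.snoc X x : Fin (k + 1) → Γ) a)) *
        dblCopy R 1 (iterDeriv R (Fin.snoc Y y : Fin (k + 1) → Γ) b) with hS
    have hstep : ∀ (X Y : Fin k → Γ) (x y : Γ),
        dblCopy R 0 (CliffordAlgebra.involute (grassmannDeriv R x (CliffordAlgebra.involute^[k] (iterDeriv R X a)))) *
            dblCopy R 1 (grassmannDeriv R y (iterDeriv R Y b)) = (-1 : R) ^ k • S X Y x y := by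
      intro X Y x y
      simp only [hS]
      rw [grassmannDeriv_involute_iterate, map_smul, map_smul, smul_mul_assoc, Function.iterate_succ_apply', iterDeriv_snoc,
        iterDeriv_snoc]
    have hinner : ∀ X Y : Fin k → Γ,
        (∏ i : Fin k, contr R (C (Fin.castSucc i)) (X i) (Y i)) •
            ∑ x, ∑ y, contr R (C (Fin.last k)) x y •
              (dblCopy R 0 (CliffordAlgebra.involute (grassmannDeriv R x (CliffordAlgebra.involute^[k] (iterDeriv R X a)))) *
                dblCopy R 1 (grassmannDeriv R y (iterDeriv R Y b))) =
          (-1 : R) ^ k • ∑ x, ∑ y, ((∏ i : Fin k, contr R (C (Fin.castSucc i)) (X i) (Y i)) * contr R (C (Fin.last k)) x y) •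
            S X Y x y := by
      intro X Y
      rw [Finset.smul_sum, Finset.smul_sum]
      refine Finset.sum_congr rfl fun x _ => ?_
      rw [Finset.smul_sum, Finset.smul_sum]
      refine Finset.sum_congr rfl fun y _ => ?_
      rw [hstep, smul_smul, smul_smul, smul_smul]
      congr 1
      ring
    have hsum : ∑ X : Fin k → Γ, ∑ Y : Fin k → Γ, (∏ i : Fin k, contr R (C (Fin.castSucc i)) (X i) (Y i)) •
          ∑ x, ∑ y, contr R (C (Fin.last k)) x y •
            (dblCopy R 0 (CliffordAlgebra.involute (grassmannDeriv R x (CliffordAlgebra.involute^[k] (iterDeriv R X a)))) *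
              dblCopy R 1 (grassmannDeriv R y (iterDeriv R Y b))) =
        (-1 : R) ^ k • ∑ X : Fin k → Γ, ∑ Y : Fin k → Γ, ∑ x, ∑ y,
          ((∏ i : Fin k, contr R (C (Fin.castSucc i)) (X i) (Y i)) * contr R (C (Fin.last k)) x y) • S X Y x y := by
      rw [Finset.smul_sum]
      refine Finset.sum_congr rfl fun X _ => ?_
      rw [Finset.smul_sum]
      exact Finset.sum_congr rfl fun Y _ => hinner X Y
    rw [hsum, smul_smul, neg_one_pow_triangle_succ R k, show (k + 1) * (k + 1 - 1) / 2 = (k + 1) * k / 2 by simp]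
    congr 1
    -- `Σ_{X,Y : Fin (k+1) → Γ} = Σ_{X,x} Σ_{Y,y}` with the product split off
    symm
    calc ∑ X : Fin (k + 1) → Γ, ∑ Y : Fin (k + 1) → Γ, (∏ i, contr R (C i) (X i) (Y i)) •
          (dblCopy R 0 (CliffordAlgebra.involute^[k + 1] (iterDeriv R X a)) * dblCopy R 1 (iterDeriv R Y b))
        = ∑ p : Γ × (Fin k → Γ), ∑ q : Γ × (Fin k → Γ),
            (∏ i, contr R (C i) ((Fin.snoc p.2 p.1 : Fin (k + 1) → Γ) i) ((Fin.snoc q.2 q.1 : Fin (k + 1) → Γ) i)) •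
              S p.2 q.2 p.1 q.1 := by
          rw [← Fintype.sum_equiv (Fin.snocEquiv fun _ => Γ) _ _ fun p => rfl]
          exact Fintype.sum_congr _ _ fun p => (Fintype.sum_equiv (Fin.snocEquiv fun _ => Γ) _ _ fun q => rfl).symm
      _ = ∑ x : Γ, ∑ X : Fin k → Γ, ∑ y : Γ, ∑ Y : Fin k → Γ,
            ((∏ i : Fin k, contr R (C (Fin.castSucc i)) (X i) (Y i)) * contr R (C (Fin.last k)) x y) • S X Y x y := by
          rw [Fintype.sum_prod_type]
          refine Finset.sum_congr rfl fun x _ => Finset.sum_congr rfl fun X _ => ?_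
          rw [Fintype.sum_prod_type]
          refine Finset.sum_congr rfl fun y _ => Finset.sum_congr rfl fun Y _ => ?_
          rw [prod_contr_snoc]
      _ = ∑ X : Fin k → Γ, ∑ Y : Fin k → Γ, ∑ x : Γ, ∑ y : Γ,
            ((∏ i : Fin k, contr R (C (Fin.castSucc i)) (X i) (Y i)) * contr R (C (Fin.last k)) x y) • S X Y x y := by
          rw [Finset.sum_comm]
          refine Finset.sum_congr rfl fun X _ => ?_
          calc ∑ x : Γ, ∑ y : Γ, ∑ Y : Fin k → Γ,
                ((∏ i : Fin k, contr R (C (Fin.castSucc i)) (X i) (Y i)) * contr R (C (Fin.last k)) x y) • S X Y x y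
              = ∑ x : Γ, ∑ Y : Fin k → Γ, ∑ y : Γ,
                  ((∏ i : Fin k, contr R (C (Fin.castSucc i)) (X i) (Y i)) * contr R (C (Fin.last k)) x y) • S X Y x y :=
                Finset.sum_congr rfl fun x _ => Finset.sum_comm
            _ = _ := Finset.sum_comm

/-- **Equal covariances**: `Δ_×(C)^k (dblCopy 0 a · dblCopy 1 b) = (−1)^{k(k−1)/2} • Σ_{X,Y} (∏_i contr C (X i) (Y i)) •
(dblCopy 0 (ι^[k] ∂_X a) · dblCopy 1 (∂_Y b))` — the `k`-line term of `e^{Δ_×(C)} = Σ_k Δ_×(C)^k/k!`.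
[cite: FeldmanKnorrerTrubowitz2002, §I.4] -/
theorem crossLaplacian_pow_copy_mul_copy (k : ℕ) (C : Matrix Γ Γ R) (a b : GrassmannAlgebra R Γ) :
    (grassmannLaplacian R (crossCov R C) ^ k) (dblCopy R 0 a * dblCopy R 1 b) =
      (-1 : R) ^ (k * (k - 1) / 2) • ∑ X : Fin k → Γ, ∑ Y : Fin k → Γ, (∏ i, contr R C (X i) (Y i)) •
        (dblCopy R 0 (CliffordAlgebra.involute^[k] (iterDeriv R X a)) * dblCopy R 1 (iterDeriv R Y b)) := by
  have h := crossLaplacian_listProd_copy_mul_copy R k (fun _ => C) a b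
  rwa [List.ofFn_const, List.reverse_replicate, List.prod_replicate] at h

end Generic

end Summit.HubbardSuperconductivity.HubbardSuperconductivity.Theorems.KLRegimeWick

end
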